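import Summits.AnomalousDissipation.AnomalousDissipation.Theorems.BaireTransferDenseLoudLerayHopfForcesAnatomy
import Summits.AnomalousDissipation.AnomalousDissipation.Theorems.DenseLoudDesignerForces.Negative.WindowBounds
import Literature.Analysis.FluidPDE.DoeringFoiasAmplitudeProofs

/-!
# `DenseLoudLerayHopfForces` (stmt-AnomalousDissipation-1149), III: the Leray–Hopf momentum budget and window bounds

Companion of `BaireTransferDefs` / `…Reductions` / `…Anatomy`.  The Doering–Foias MULTIPLIER ARGUMENT for
global Leray–Hopf solutions with a GENERAL steady smooth mean-zero force `f` on `T^d` tested against a GENERAL steady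
smooth solenoidal field `φ` (the tree's `DoeringFoias.abs_amplitude_le_of_isGlobalLerayHopf` is the special case
`f = F Φ(n • ·)`, `φ = Φ(n • ·)`; same proof, Cheskidov–Doering–Petrov 2007 §III (18), Doering–Foias 2002 §3):

* §1 `pairing_mul_eq_of_isGlobalLerayHopf` — the momentum equation tested with `φ` (time-sliced weak formulation
  `Torus.IsLerayHopfOn.integral_inner_eq_add_setIntegral`):
  `t ∫⟪f,φ⟫ = ∫⟪u(t),φ⟫ - ∫⟪u₀,φ⟫ - ∫₀ᵗ∫⟪u,(u·∇)φ⟫ - ν∫₀ᵗ∫⟪u,Δφ⟫`;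
  `abs_pairing_mul_le_of_isGlobalLerayHopf` — `|∫⟪f,φ⟫| t ≤ ‖φ‖_∞‖u(t)‖₂ + |∫⟪u₀,φ⟫| + M∫₀ᵗ‖u‖₂² + |ν|‖Δφ‖_∞∫₀ᵗ‖u‖₂`
  for `‖Dφ‖ ≤ M`; `integral_norm_sq_le_of_isGlobalLerayHopf` — `‖u(t)‖₂² ≤ ‖u₀‖₂² + 2‖f‖_∞∫₀ᵗ‖u‖₂` (energy
  inequality); and the `limsup` form `abs_pairing_le_of_isGlobalLerayHopf`:
  `|∫⟪f,φ⟫| ≤ M ⟨‖u‖²⟩ + ν ‖Δφ‖_∞ ⟨‖u‖²⟩^{1/2}` for EVERY global Leray–Hopf solution and EVERY datum (the Cesàro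
  energies are bounded a priori, `Torus.IsGlobalLerayHopf.timeMean_norm_sq_le`, so the `limsup` is honest).
* §2 Consequences for the item (`d = 3`, `f = f_c`): on `LHLOUD_j(S,E,ε)`,
  `|∫⟪f_c,φ⟫| ≤ M E + ‖Δφ‖_∞ √E/(j+1)` (`abs_pairing_le_of_mem_lhLoudSet`, and on the closure by continuity in
  `c`); on an LH-WINDOW, uniformly in the level, `|∫⟪f_c,φ⟫| ≤ M E` for every steady smooth solenoidal `φ` with
  `‖Dφ‖ ≤ M` (`abs_pairing_le_of_lhWindow`); with `φ = f_c`: `∫‖f_c‖² ≤ Λ(c)E` and the HEADLINE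
  `ε² ≤ Λ(c)E² ≤ Λ₁(S)‖c‖E²` at every point of every LH-window (`sq_le_gradBound_mul_sq_of_lhWindow`) — the window
  bounds of the crux (`Negative.WindowBounds`, periodic classical witnesses) persist verbatim for Leray–Hopf
  witnesses from arbitrary data: an LH-window's forces are `O(E·|k|)` in every solenoidal direction and its
  dissipation floor is `O(E√(|k|‖c‖))`.
-/

noncomputable section

-- `Summit.<Summit>.<Problem>` is the tree's mandated summit-side namespace (CONVENTIONS §2); for this
-- single-conjunct summit the two coincide, so the duplicate is deliberate.
set_option linter.dupNamespace false

namespace Summit.AnomalousDissipation.AnomalousDissipation.Theorems.DenseLoudLerayHopfForces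

open scoped BigOperators Topology ENNReal InnerProductSpace RealInnerProductSpace
open Filter Set MeasureTheory UnitAddTorus
open Literature.Analysis.FunctionSpaces Literature.Analysis.FluidPDE
open Summit.AnomalousDissipation.AnomalousDissipation.Theses.BaireTransfer
open Summit.AnomalousDissipation.AnomalousDissipation.Theorems.DenseLoudDesignerForces.Negative

/-! ## §1 The multiplier argument for a general steady force and a general steady solenoidal test field -/

section General

variable {d : Type*} [Fintype d] [DecidableEq d]
variable {ν : ℝ} {f φ : UnitAddTorus d → EuclideanSpace ℝ d}
  {u₀ : UnitAddTorus d → EuclideanSpace ℝ d} {u : ℝ → UnitAddTorus d → EuclideanSpace ℝ d}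

/-- MOMENTUM IDENTITY: for a global Leray–Hopf solution driven by the steady smooth force `f` and a steady smooth
solenoidal `φ`, for every `t > 0`,
`(∫⟪f,φ⟫) t = ∫⟪u(t),φ⟫ - ∫⟪u₀,φ⟫ - ∫₀ᵗ∫⟪u,(u·∇)φ⟫ - ν∫₀ᵗ∫⟪u,Δφ⟫`
(time-sliced weak formulation tested with `φ`; Temam 1984 Ch. III (1.25)). -/
theorem pairing_mul_eq_of_isGlobalLerayHopf (hf : Torus.IsSmooth f) (hφ : Torus.IsSmooth φ)
    (hφdiv : Torus.IsDivFree φ) (hu : Torus.IsGlobalLerayHopf ν (fun _ => f) u₀ u) {t : ℝ} (ht : 0 < t) :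
    (∫ x, ⟪f x, φ x⟫) * t = (∫ x, ⟪u t x, φ x⟫) - (∫ x, ⟪u₀ x, φ x⟫) -
      (∫ s in Ioc 0 t, ∫ x, ⟪u s x, Torus.convect (u s) φ x⟫) -
        ν * ∫ s in Ioc 0 t, ∫ x, ⟪u s x, Torus.laplacian φ x⟫ := by
  have hfm := aestronglyMeasurable_stLift_const hf (volume.restrict (Ioo 0 t ×ˢ univ))
  have hf₂ := lintegral_enorm_sq_const_lt_top hf t
  have hid := (hu t ht).integral_inner_eq_add_setIntegral ht hfm hf₂ hφ hφdiv ⟨ht, le_rfl⟩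
  set Pf : ℝ := ∫ x, ⟪f x, φ x⟫ with hPf
  have hmem : ∀ s ∈ Ioc (0 : ℝ) t, MemLp (u s) 2 volume := fun s hs => hu.memLp_two hs.1.le
  have hsplit : ∀ s ∈ Ioc (0 : ℝ) t,
      (∫ x, (⟪u s x, Torus.convect (u s) φ x⟫ + ν * ⟪u s x, Torus.laplacian φ x⟫ + ⟪f x, φ x⟫)) =
      (∫ x, ⟪u s x, Torus.convect (u s) φ x⟫) + ν * (∫ x, ⟪u s x, Torus.laplacian φ x⟫) + Pf := by
    intro s hs
    have i1 := Torus.integrable_inner_convect_self (hmem s hs) hφ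
    have i2 : Integrable (fun x => ⟪u s x, Torus.laplacian φ x⟫) volume :=
      Torus.integrable_inner_of_continuous ((hmem s hs).integrable one_le_two) hφ.laplacian.continuous
    have i3 : Integrable (fun x => ⟪f x, φ x⟫) volume :=
      Torus.integrable_inner_of_continuous ((hf.memLp 2).integrable one_le_two) hφ.continuous
    have i12 : Integrable (fun x => ⟪u s x, Torus.convect (u s) φ x⟫ +
        ν * ⟪u s x, Torus.laplacian φ x⟫) volume := i1.add (i2.const_mul ν)
    rw [integral_add i12 i3, integral_add i1 (i2.const_mul ν), integral_const_mul]
  have hD : IntegrableOn (fun s => ∫ x, ⟪u s x, Torus.laplacian φ x⟫) (Ioc 0 t) :=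
    (integrableOn_Ioc_iff_integrableOn_Ioo).mpr
      ((hu t ht).integrableOn_integral_inner hφ.laplacian.continuous)
  have hFl : IntegrableOn (fun s => ∫ x, (⟪u s x, Torus.convect (u s) φ x⟫ +
      ν * ⟪u s x, Torus.laplacian φ x⟫ + ⟪f x, φ x⟫)) (Ioc 0 t) :=
    (integrableOn_Ioc_iff_integrableOn_Ioo).mpr ((hu t ht).integrableOn_flux hfm hf₂ hφ)
  haveI : IsFiniteMeasure (volume.restrict (Ioc (0 : ℝ) t)) :=
    isFiniteMeasure_restrict.mpr measure_Ioc_lt_top.ne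
  have hC : IntegrableOn (fun s => ∫ x, ⟪u s x, Torus.convect (u s) φ x⟫) (Ioc 0 t) := by
    have h : IntegrableOn (fun s => (∫ x, (⟪u s x, Torus.convect (u s) φ x⟫ +
        ν * ⟪u s x, Torus.laplacian φ x⟫ + ⟪f x, φ x⟫)) -
        ν * (∫ x, ⟪u s x, Torus.laplacian φ x⟫) - Pf) (Ioc 0 t) :=
      (hFl.sub (hD.const_mul ν)).sub (integrableOn_const measure_Ioc_lt_top.ne)
    refine h.congr_fun (fun s hs => ?_) measurableSet_Ioc
    simp only
    rw [hsplit s hs]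
    ring
  have hint : ∫ s in Ioc 0 t, (∫ x, (⟪u s x, Torus.convect (u s) φ x⟫ +
      ν * ⟪u s x, Torus.laplacian φ x⟫ + ⟪f x, φ x⟫)) =
      (∫ s in Ioc 0 t, ∫ x, ⟪u s x, Torus.convect (u s) φ x⟫) +
        ν * (∫ s in Ioc 0 t, ∫ x, ⟪u s x, Torus.laplacian φ x⟫) + Pf * t := by
    have hCD : IntegrableOn (fun s => (∫ x, ⟪u s x, Torus.convect (u s) φ x⟫) +
        ν * (∫ x, ⟪u s x, Torus.laplacian φ x⟫)) (Ioc 0 t) := hC.add (hD.const_mul ν)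
    rw [setIntegral_congr_fun measurableSet_Ioc hsplit, integral_add hCD (integrable_const Pf),
      integral_add hC (hD.const_mul ν), integral_const_mul]
    congr 1
    rw [setIntegral_const, Real.volume_real_Ioc_of_le ht.le, sub_zero, smul_eq_mul, mul_comm]
  beta_reduce at hid
  rw [hint] at hid
  linarith

/-- POINTWISE-IN-TIME MOMENTUM BOUND: with `‖φ‖ ≤ KP`, `‖Dφ(x)w‖ ≤ M‖w‖`, `‖Δφ‖ ≤ KL`, `E(s) = ‖u(s)‖₂²`, for every
`t > 0`, `|∫⟪f,φ⟫| t ≤ KP E(t)^{1/2} + |∫⟪u₀,φ⟫| + M ∫₀ᵗ E + |ν| KL ∫₀ᵗ √E`. -/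
theorem abs_pairing_mul_le_of_isGlobalLerayHopf (hf : Torus.IsSmooth f) (hφ : Torus.IsSmooth φ)
    (hφdiv : Torus.IsDivFree φ) (hu : Torus.IsGlobalLerayHopf ν (fun _ => f) u₀ u)
    {KP M KL : ℝ} (hKP : 0 ≤ KP) (hKL : 0 ≤ KL) (hP : ∀ x, ‖φ x‖ ≤ KP)
    (hM : ∀ x w, ‖Torus.fderiv φ x w‖ ≤ M * ‖w‖) (hL : ∀ x, ‖Torus.laplacian φ x‖ ≤ KL)
    {t : ℝ} (ht : 0 < t) :
    |∫ x, ⟪f x, φ x⟫| * t ≤ KP * Real.sqrt (∫ x, ‖u t x‖ ^ 2) + |∫ x, ⟪u₀ x, φ x⟫| +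
      M * (∫ s in Ioc 0 t, ∫ x, ‖u s x‖ ^ 2) +
        |ν| * KL * ∫ s in Ioc 0 t, Real.sqrt (∫ x, ‖u s x‖ ^ 2) := by
  have hid := pairing_mul_eq_of_isGlobalLerayHopf hf hφ hφdiv hu ht
  have hE := hu.integrableOn_integral_norm_sq ht
  have hsqE := hu.integrableOn_sqrt_integral_norm_sq ht
  have b1 : |∫ x, ⟪u t x, φ x⟫| ≤ KP * Real.sqrt (∫ x, ‖u t x‖ ^ 2) := by
    have hm := hu.memLp_two ht.le
    exact (Torus.abs_integral_inner_le_of_norm_le (hm.integrable one_le_two) hP).trans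
      (mul_le_mul_of_nonneg_left (integral_norm_le_sqrt_integral_norm_sq hm) hKP)
  -- the convective pairing: `|∫⟪U,(U·∇)φ⟫| ≤ M ∫‖U‖²` slice-wise (`(U·∇)φ = Dφ[U]`)
  have hconv : ∀ s ∈ Ioc (0 : ℝ) t, |∫ x, ⟪u s x, Torus.convect (u s) φ x⟫| ≤ M * ∫ x, ‖u s x‖ ^ 2 := by
    intro s hs
    have hm := hu.memLp_two hs.1.le
    have hb := norm_integral_le_of_norm_le ((hm.integrable_norm_pow two_ne_zero).const_mul M)
      (ae_of_all _ fun x => show ‖⟪u s x, Torus.convect (u s) φ x⟫‖ ≤ M * ‖u s x‖ ^ 2 from by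
        rw [Real.norm_eq_abs]
        calc |⟪u s x, Torus.convect (u s) φ x⟫| ≤ ‖u s x‖ * ‖Torus.convect (u s) φ x‖ :=
              abs_real_inner_le_norm _ _
          _ ≤ ‖u s x‖ * (M * ‖u s x‖) := by
              gcongr
              exact hM x (u s x)
          _ = M * ‖u s x‖ ^ 2 := by ring)
    rw [Real.norm_eq_abs, integral_const_mul] at hb
    exact hb
  have b3 : |∫ s in Ioc 0 t, ∫ x, ⟪u s x, Torus.convect (u s) φ x⟫| ≤
      M * ∫ s in Ioc 0 t, ∫ x, ‖u s x‖ ^ 2 := by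
    rw [← integral_const_mul]
    refine abs_integral_le_integral_abs.trans (integral_mono_of_nonneg
      (ae_of_all _ fun s => abs_nonneg _) (hE.const_mul M) ?_)
    filter_upwards [ae_restrict_mem measurableSet_Ioc] with s hs
    exact hconv s hs
  have b4 : |∫ s in Ioc 0 t, ∫ x, ⟪u s x, Torus.laplacian φ x⟫| ≤
      KL * ∫ s in Ioc 0 t, Real.sqrt (∫ x, ‖u s x‖ ^ 2) := by
    rw [← integral_const_mul]
    refine abs_integral_le_integral_abs.trans (integral_mono_of_nonneg
      (ae_of_all _ fun s => abs_nonneg _) (hsqE.const_mul KL) ?_)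
    filter_upwards [ae_restrict_mem measurableSet_Ioc] with s hs
    have hm := hu.memLp_two hs.1.le
    exact (Torus.abs_integral_inner_le_of_norm_le (hm.integrable one_le_two) hL).trans
      (mul_le_mul_of_nonneg_left (integral_norm_le_sqrt_integral_norm_sq hm) hKL)
  have b4' : |ν * ∫ s in Ioc 0 t, ∫ x, ⟪u s x, Torus.laplacian φ x⟫| ≤
      |ν| * KL * ∫ s in Ioc 0 t, Real.sqrt (∫ x, ‖u s x‖ ^ 2) := by
    rw [abs_mul, mul_assoc]
    exact mul_le_mul_of_nonneg_left b4 (abs_nonneg ν)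
  have habs : |∫ x, ⟪f x, φ x⟫| * t = |(∫ x, ⟪f x, φ x⟫) * t| := by rw [abs_mul, abs_of_pos ht]
  rw [habs, hid]
  calc |(∫ x, ⟪u t x, φ x⟫) - (∫ x, ⟪u₀ x, φ x⟫) -
        (∫ s in Ioc 0 t, ∫ x, ⟪u s x, Torus.convect (u s) φ x⟫) -
          ν * ∫ s in Ioc 0 t, ∫ x, ⟪u s x, Torus.laplacian φ x⟫|
      ≤ |∫ x, ⟪u t x, φ x⟫| + |∫ x, ⟪u₀ x, φ x⟫| +
          |∫ s in Ioc 0 t, ∫ x, ⟪u s x, Torus.convect (u s) φ x⟫| +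
            |ν * ∫ s in Ioc 0 t, ∫ x, ⟪u s x, Torus.laplacian φ x⟫| := by
        refine (abs_sub _ _).trans (add_le_add ((abs_sub _ _).trans (add_le_add
          (abs_sub _ _) le_rfl)) le_rfl)
    _ ≤ _ := by linarith

/-- ENERGY GROWTH `‖u(t)‖₂² = O(t)`: for a global Leray–Hopf solution driven by the steady smooth force `f` with
`‖f‖ ≤ KF` and `ν ≥ 0`, `‖u(t)‖₂² ≤ ‖u₀‖₂² + 2 KF ∫₀ᵗ ‖u(s)‖₂ ds` (energy inequality from `0`, dissipation dropped,
`|∫⟪f,u⟫| ≤ KF‖u‖₁ ≤ KF‖u‖₂`). -/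
theorem integral_norm_sq_le_of_isGlobalLerayHopf (hν : 0 ≤ ν) (hu : Torus.IsGlobalLerayHopf ν (fun _ => f) u₀ u)
    {KF : ℝ} (hKF : 0 ≤ KF) (hF : ∀ x, ‖f x‖ ≤ KF) {t : ℝ} (ht : 0 < t) :
    ∫ x, ‖u t x‖ ^ 2 ≤ (∫ x, ‖u₀ x‖ ^ 2) + 2 * KF * ∫ s in Ioc 0 t, Real.sqrt (∫ x, ‖u s x‖ ^ 2) := by
  have hen := (hu t ht).energy_ineq_zero t ⟨ht.le, le_rfl⟩
  have hdiss : 0 ≤ ν * (∫⁻ τ in Ioo 0 t, Torus.eGradNormSq (u τ)).toReal :=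
    mul_nonneg hν ENNReal.toReal_nonneg
  have hsqE := hu.integrableOn_sqrt_integral_norm_sq ht
  have hfP : ∀ s ∈ Ioc (0 : ℝ) t, |∫ x, ⟪f x, u s x⟫| ≤ KF * Real.sqrt (∫ x, ‖u s x‖ ^ 2) := fun s hs =>
    abs_integral_inner_le_mul_sqrt (hu.memLp_two hs.1.le) hKF hF
  have hforce : ∫ τ in (0 : ℝ)..t, ∫ x, ⟪f x, u τ x⟫ ≤ KF * ∫ s in Ioc 0 t, Real.sqrt (∫ x, ‖u s x‖ ^ 2) := by
    rw [intervalIntegral.integral_of_le ht.le, ← integral_const_mul]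
    refine (le_abs_self _).trans (abs_integral_le_integral_abs.trans
      (integral_mono_of_nonneg (ae_of_all _ fun s => abs_nonneg _) (hsqE.const_mul _) ?_))
    filter_upwards [ae_restrict_mem measurableSet_Ioc] with s hs
    exact hfP s hs
  have hKE : ∀ v : UnitAddTorus d → EuclideanSpace ℝ d, Torus.kineticEnergy v = 2⁻¹ * ∫ x, ‖v x‖ ^ 2 :=
    fun v => rfl
  beta_reduce at hen
  rw [hKE, hKE] at hen
  nlinarith [hen, hforce, hdiss]

/-- **THE LERAY–HOPF MOMENTUM BUDGET** (Doering–Foias multiplier bound, general steady force and multiplier): for a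
global Leray–Hopf solution on `T^d` driven by a steady smooth MEAN-ZERO force `f` at viscosity `ν > 0`, every steady
smooth solenoidal `φ` with `‖Dφ(x)w‖ ≤ M‖w‖` (`M ≥ 0`) and `‖Δφ‖ ≤ KL` satisfies
`|∫⟪f,φ⟫| ≤ M ⟨‖u‖²⟩ + ν KL ⟨‖u‖²⟩^{1/2}`, `⟨‖u‖²⟩ = meanEnergy u` (`limsup` Cesàro mean, honest: the Cesàro
energies are bounded a priori, `Torus.IsGlobalLerayHopf.timeMean_norm_sq_le`).  The datum is arbitrary. -/
theorem abs_pairing_le_of_isGlobalLerayHopf (hν : 0 < ν) (hf : Torus.IsSmooth f) (hf0 : Torus.HasZeroMean f)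
    (hφ : Torus.IsSmooth φ) (hφdiv : Torus.IsDivFree φ) (hu : Torus.IsGlobalLerayHopf ν (fun _ => f) u₀ u)
    {M KL : ℝ} (hM0 : 0 ≤ M) (hM : ∀ x w, ‖Torus.fderiv φ x w‖ ≤ M * ‖w‖) (hKL : 0 ≤ KL)
    (hL : ∀ x, ‖Torus.laplacian φ x‖ ≤ KL) :
    |∫ x, ⟪f x, φ x⟫| ≤ M * meanEnergy u + ν * KL * Real.sqrt (meanEnergy u) := by
  obtain ⟨KP, hKP, hP⟩ := Torus.exists_nonneg_forall_norm_le_of_continuous hφ.continuous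
  obtain ⟨KF, hKF, hF⟩ := Torus.exists_nonneg_forall_norm_le_of_continuous hf.continuous
  set A : ℝ := |∫ x, ⟪f x, φ x⟫| with hAdef
  have hE0 : ∀ s, 0 ≤ ∫ x, ‖u s x‖ ^ 2 := fun s => integral_nonneg fun x => sq_nonneg _
  -- bounded running means of the energy (a-priori energy estimate) and their `limsup`
  have heb : IsBoundedUnder (· ≤ ·) atTop (timeMean fun s => ∫ x, ‖u s x‖ ^ 2) :=
    isBoundedUnder_of_eventually_le (eventually_atTop.2 ⟨1, fun t ht =>
      hu.timeMean_norm_sq_le hν hf hf0 ht⟩)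
  have heU : limsup (timeMean fun s => ∫ x, ‖u s x‖ ^ 2) atTop = meanEnergy u := rfl
  obtain ⟨B, hB⟩ := heb
  rw [Filter.eventually_map] at hB
  -- Cauchy–Schwarz for the running means of `√E`
  have hIS : ∀ t, 0 < t → (∫ s in Ioc 0 t, Real.sqrt (∫ x, ‖u s x‖ ^ 2)) ≤
      t * Real.sqrt (timeMean (fun s => ∫ x, ‖u s x‖ ^ 2) t) := by
    intro t ht
    have hJ := timeMean_sqrt_le_sqrt_timeMean ht hE0 (hu.integrableOn_integral_norm_sq ht)
    rw [timeMean, intervalIntegral.integral_of_le ht.le] at hJ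
    have h2 := mul_le_mul_of_nonneg_left hJ ht.le
    rwa [← mul_assoc, mul_inv_cancel₀ ht.ne', one_mul] at h2
  have hIE : ∀ t, 0 < t → (∫ s in Ioc 0 t, ∫ x, ‖u s x‖ ^ 2) =
      t * timeMean (fun s => ∫ x, ‖u s x‖ ^ 2) t := by
    intro t ht
    rw [timeMean, intervalIntegral.integral_of_le ht.le, ← mul_assoc, mul_inv_cancel₀ ht.ne',
      one_mul]
  -- running-mean form of the pointwise bound, for `t > 0`
  have hstep : ∀ t, 0 < t → A ≤ KP * Real.sqrt (∫ x, ‖u t x‖ ^ 2) / t +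
      |∫ x, ⟪u₀ x, φ x⟫| / t + M * timeMean (fun s => ∫ x, ‖u s x‖ ^ 2) t +
        |ν| * KL * Real.sqrt (timeMean (fun s => ∫ x, ‖u s x‖ ^ 2) t) := by
    intro t ht
    have h := abs_pairing_mul_le_of_isGlobalLerayHopf hf hφ hφdiv hu hKP hKL hP hM hL ht
    rw [hIE t ht] at h
    have h3 := mul_le_mul_of_nonneg_left (hIS t ht) (mul_nonneg (abs_nonneg ν) hKL)
    have h' : A * t ≤ KP * Real.sqrt (∫ x, ‖u t x‖ ^ 2) + |∫ x, ⟪u₀ x, φ x⟫| +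
        M * (t * timeMean (fun s => ∫ x, ‖u s x‖ ^ 2) t) +
          |ν| * KL * (t * Real.sqrt (timeMean (fun s => ∫ x, ‖u s x‖ ^ 2) t)) := by
      rw [hAdef]; linarith
    rw [← le_div_iff₀ ht] at h'
    refine h'.trans_eq ?_
    field_simp
  -- the energy grows at most linearly: `E t ≤ E₀ + (2 KF √B₊) t` eventually
  have hgrowth : ∀ᶠ t in atTop, ∫ x, ‖u t x‖ ^ 2 ≤
      (∫ x, ‖u₀ x‖ ^ 2) + (2 * KF * Real.sqrt (max B 0)) * t := by
    filter_upwards [hB, eventually_gt_atTop (0 : ℝ)] with t hBt ht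
    have h := integral_norm_sq_le_of_isGlobalLerayHopf hν.le hu hKF hF ht
    have h2 : Real.sqrt (timeMean (fun s => ∫ x, ‖u s x‖ ^ 2) t) ≤ Real.sqrt (max B 0) :=
      Real.sqrt_le_sqrt (hBt.trans (le_max_left _ _))
    have h3 : (∫ s in Ioc 0 t, Real.sqrt (∫ x, ‖u s x‖ ^ 2)) ≤ t * Real.sqrt (max B 0) :=
      (hIS t ht).trans (mul_le_mul_of_nonneg_left h2 ht.le)
    have h4 := mul_le_mul_of_nonneg_left h3 (by positivity : 0 ≤ 2 * KF)
    linarith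
  have hvanish : Tendsto (fun t => KP * Real.sqrt ((∫ x, ‖u₀ x‖ ^ 2) +
      (2 * KF * Real.sqrt (max B 0)) * t) / t + |∫ x, ⟪u₀ x, φ x⟫| / t)
      atTop (𝓝 0) := by
    have h1 := (tendsto_sqrt_add_mul_div_atTop (∫ x, ‖u₀ x‖ ^ 2)
      (2 * KF * Real.sqrt (max B 0))).const_mul KP
    have h2 := (tendsto_inv_atTop_zero : Tendsto (fun r : ℝ => r⁻¹) atTop (𝓝 0)).const_mul
      |∫ x, ⟪u₀ x, φ x⟫|
    rw [mul_zero] at h1 h2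
    have h := h1.add h2
    rw [add_zero] at h
    refine h.congr' ?_
    filter_upwards [eventually_gt_atTop (0 : ℝ)] with t ht
    simp only [div_eq_mul_inv]
    ring
  -- the `δ`-argument on the constant `A`
  have key : ∀ δ, 0 < δ → A ≤ δ + M * (meanEnergy u + δ) + |ν| * KL * Real.sqrt (meanEnergy u + δ) := by
    intro δ hδ
    have heδ : ∀ᶠ t in atTop, timeMean (fun s => ∫ x, ‖u s x‖ ^ 2) t < meanEnergy u + δ :=
      eventually_lt_of_limsup_lt (by rw [heU]; linarith) ⟨B, Filter.eventually_map.mpr hB⟩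
    have hvδ := hvanish.eventually (gt_mem_nhds hδ)
    obtain ⟨t, ht0, hgt, het, hvt⟩ :=
      ((eventually_gt_atTop (0 : ℝ)).and (hgrowth.and (heδ.and hvδ))).exists
    have h1 : KP * Real.sqrt (∫ x, ‖u t x‖ ^ 2) / t ≤
        KP * Real.sqrt ((∫ x, ‖u₀ x‖ ^ 2) + (2 * KF * Real.sqrt (max B 0)) * t) / t :=
      div_le_div_of_nonneg_right (mul_le_mul_of_nonneg_left (Real.sqrt_le_sqrt hgt) hKP) ht0.le
    have h2 : M * timeMean (fun s => ∫ x, ‖u s x‖ ^ 2) t ≤ M * (meanEnergy u + δ) :=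
      mul_le_mul_of_nonneg_left het.le hM0
    have h3 : |ν| * KL * Real.sqrt (timeMean (fun s => ∫ x, ‖u s x‖ ^ 2) t) ≤
        |ν| * KL * Real.sqrt (meanEnergy u + δ) :=
      mul_le_mul_of_nonneg_left (Real.sqrt_le_sqrt het.le) (mul_nonneg (abs_nonneg ν) hKL)
    linarith [hstep t ht0]
  have hcont : Continuous fun δ : ℝ => δ + M * (meanEnergy u + δ) + |ν| * KL * Real.sqrt (meanEnergy u + δ) :=
    (continuous_id.add (continuous_const.mul (continuous_const.add continuous_id))).add
      (continuous_const.mul ((continuous_const.add continuous_id).sqrt))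
  have h0 : (fun δ : ℝ => δ + M * (meanEnergy u + δ) + |ν| * KL * Real.sqrt (meanEnergy u + δ)) 0 =
      M * meanEnergy u + ν * KL * Real.sqrt (meanEnergy u) := by
    simp [abs_of_pos hν]
  rw [← h0]
  have hlim : Tendsto (fun δ : ℝ => δ + M * (meanEnergy u + δ) + |ν| * KL * Real.sqrt (meanEnergy u + δ))
      (𝓝[>] 0) (𝓝 ((fun δ : ℝ => δ + M * (meanEnergy u + δ) + |ν| * KL * Real.sqrt (meanEnergy u + δ)) 0)) :=
    (hcont.tendsto 0).mono_left nhdsWithin_le_nhds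
  exact ge_of_tendsto hlim (by filter_upwards [self_mem_nhdsWithin] with δ hδ using key δ hδ)

end General

/-! ## §2 Consequences for the item: momentum budget on the Leray–Hopf loud sets and LH-windows -/

section Consequences

variable {S : Finset (Fin 3 → ℤ)} {E ε : ℝ} {φ : (UnitAddTorus (Fin 3)) → (EuclideanSpace ℝ (Fin 3))} {M : ℝ}

/-- MOMENTUM BUDGET ON A LERAY–HOPF LOUD SET: `c ∈ LHLOUD_j(S,E,ε)` ⇒
`|∫⟪f_c, φ⟫| ≤ M E + ‖Δφ‖_∞ √E / (j+1)` for every steady smooth solenoidal `φ` with `‖Dφ‖ ≤ M`, `‖Δφ‖ ≤ KL`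
(the witness may start from ANY finite-energy datum). -/
theorem abs_pairing_le_of_mem_lhLoudSet {j : ℕ} {c : ↥S → (EuclideanSpace ℂ (Fin 3))} (hc : c ∈ lhLoudSet S E ε j)
    (hφ : Torus.IsSmooth φ) (hdiv : Torus.IsDivFree φ) (hM : ∀ x w, ‖Torus.fderiv φ x w‖ ≤ M * ‖w‖)
    {KL : ℝ} (hKL : 0 ≤ KL) (hL : ∀ x, ‖Torus.laplacian φ x‖ ≤ KL) :
    |∫ x, ⟪force S c x, φ x⟫_ℝ| ≤ M * E + KL * Real.sqrt E / ((j : ℝ) + 1) := by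
  obtain ⟨ν, hν, hνj, u₀, u, hu, hEu, -⟩ := hc
  have hM0 := nonneg_of_fderiv_bound hM
  have h := abs_pairing_le_of_isGlobalLerayHopf hν (isSmooth_force S c) (hasZeroMean_force S c) hφ hdiv hu
    hM0 hM hKL hL
  have h1 : M * meanEnergy u ≤ M * E := mul_le_mul_of_nonneg_left hEu hM0
  have hj : (0 : ℝ) < (j : ℝ) + 1 := by positivity
  have hs : Real.sqrt (meanEnergy u) ≤ Real.sqrt E := Real.sqrt_le_sqrt hEu
  have h2 : ν * KL * Real.sqrt (meanEnergy u) ≤ KL * Real.sqrt E / ((j : ℝ) + 1) := by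
    calc ν * KL * Real.sqrt (meanEnergy u) ≤ (1 / ((j : ℝ) + 1)) * KL * Real.sqrt E :=
          mul_le_mul (mul_le_mul_of_nonneg_right hνj.le hKL) hs (Real.sqrt_nonneg _) (by positivity)
      _ = KL * Real.sqrt E / ((j : ℝ) + 1) := by ring
  linarith

/-- … and the same bound persists on the CLOSURE of the Leray–Hopf loud set (continuity of `c ↦ ∫⟪f_c, φ⟫`). -/
theorem abs_pairing_le_of_mem_closure_lhLoudSet {j : ℕ} {c : ↥S → (EuclideanSpace ℂ (Fin 3))}
    (hc : c ∈ closure (lhLoudSet S E ε j)) (hφ : Torus.IsSmooth φ) (hdiv : Torus.IsDivFree φ)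
    (hM : ∀ x w, ‖Torus.fderiv φ x w‖ ≤ M * ‖w‖) {KL : ℝ} (hKL : 0 ≤ KL) (hL : ∀ x, ‖Torus.laplacian φ x‖ ≤ KL) :
    |∫ x, ⟪force S c x, φ x⟫_ℝ| ≤ M * E + KL * Real.sqrt E / ((j : ℝ) + 1) := by
  have hclosed : IsClosed {c : ↥S → (EuclideanSpace ℂ (Fin 3)) |
      |∫ x, ⟪force S c x, φ x⟫_ℝ| ≤ M * E + KL * Real.sqrt E / ((j : ℝ) + 1)} :=
    isClosed_le (continuous_abs.comp (continuous_pairing S hφ.continuous)) continuous_const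
  exact closure_minimal (fun c hc => abs_pairing_le_of_mem_lhLoudSet hc hφ hdiv hM hKL hL) hclosed hc

/-- MOMENTUM BUDGET ON AN LH-WINDOW: for `c` in an LH-window, `|∫⟪f_c, φ⟫| ≤ ‖Dφ‖_∞ · E` for every steady smooth
solenoidal `φ` — uniformly in the level, the viscous remainder `‖Δφ‖_∞√E/(j+1)` having gone to zero. -/
theorem abs_pairing_le_of_lhWindow {U : Set (↥S → (EuclideanSpace ℂ (Fin 3)))}
    (hU : ∀ j : ℕ, U ⊆ closure (lhLoudSet S E ε j)) {c : ↥S → (EuclideanSpace ℂ (Fin 3))} (hc : c ∈ U)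
    (hφ : Torus.IsSmooth φ) (hdiv : Torus.IsDivFree φ) (hM : ∀ x w, ‖Torus.fderiv φ x w‖ ≤ M * ‖w‖) :
    |∫ x, ⟪force S c x, φ x⟫_ℝ| ≤ M * E := by
  obtain ⟨KL, hKL, hL⟩ := Torus.exists_nonneg_forall_norm_le_of_continuous hφ.laplacian.continuous
  set K : ℝ := KL * Real.sqrt E with hK
  refine le_of_forall_pos_le_add fun δ hδ => ?_
  obtain ⟨j, hj⟩ := exists_nat_gt (|K| / δ)
  have hj1 : (0 : ℝ) < (j : ℝ) + 1 := by positivity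
  have h := abs_pairing_le_of_mem_closure_lhLoudSet (hU j hc) hφ hdiv hM hKL hL
  have hKj : K / ((j : ℝ) + 1) ≤ δ := by
    rw [div_le_iff₀ hj1]
    have h1 : |K| / δ < (j : ℝ) + 1 := hj.trans (lt_add_one _)
    rw [div_lt_iff₀ hδ] at h1
    calc K ≤ |K| := le_abs_self K
      _ ≤ δ * ((j : ℝ) + 1) := by nlinarith
  have : M * E + KL * Real.sqrt E / ((j : ℝ) + 1) = M * E + K / ((j : ℝ) + 1) := by rw [hK]
  linarith

/-- SELF-PAIRING ON AN LH-WINDOW: `∫‖f_c‖² ≤ Λ(c)·E` for every `c` in an LH-window, `Λ(c) = gradBound S c`. -/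
theorem forceEnergy_le_of_lhWindow {U : Set (↥S → (EuclideanSpace ℂ (Fin 3)))}
    (hU : ∀ j : ℕ, U ⊆ closure (lhLoudSet S E ε j)) {c : ↥S → (EuclideanSpace ℂ (Fin 3))} (hc : c ∈ U) :
    ∫ x, ‖force S c x‖ ^ 2 ≤ gradBound S c * E := by
  have h := abs_pairing_le_of_lhWindow hU hc (isSmooth_force S c) (isDivFree_force S c) (norm_fderiv_force_le S c)
  have heq : ∫ x, ⟪force S c x, force S c x⟫_ℝ = ∫ x, ‖force S c x‖ ^ 2 :=
    integral_congr_ae (ae_of_all _ fun x => real_inner_self_eq_norm_sq _)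
  rw [heq] at h
  exact (le_abs_self _).trans h

/-- HEADLINE: on every LH-window `ε² ≤ Λ(c)·E²` — the dissipation floor is at most the energy budget times the square
root of the force-gradient bound, at EVERY point of the window, for witnesses in the full Leray–Hopf class. -/
theorem sq_le_gradBound_mul_sq_of_lhWindow (hε : 0 < ε) {U : Set (↥S → (EuclideanSpace ℂ (Fin 3)))}
    (hU : ∀ j : ℕ, U ⊆ closure (lhLoudSet S E ε j)) {c : ↥S → (EuclideanSpace ℂ (Fin 3))} (hc : c ∈ U) :
    ε ^ 2 ≤ gradBound S c * E ^ 2 := by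
  have hE := (energy_pos_of_subset_closure_lhLoudSet hε (hU 0) ⟨c, hc⟩).le
  have hclosed : IsClosed {c : ↥S → (EuclideanSpace ℂ (Fin 3)) | ε ^ 2 ≤ (∫ x, ‖force S c x‖ ^ 2) * E} :=
    isClosed_le continuous_const ((continuous_forceEnergy S).mul continuous_const)
  have h1 : ε ^ 2 ≤ (∫ x, ‖force S c x‖ ^ 2) * E :=
    closure_minimal (fun c hc => sq_le_integral_force_mul_of_mem_lhLoudSet hε.le hc) hclosed (hU 0 hc)
  calc ε ^ 2 ≤ (∫ x, ‖force S c x‖ ^ 2) * E := h1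
    _ ≤ gradBound S c * E * E := mul_le_mul_of_nonneg_right (forceEnergy_le_of_lhWindow hU hc) hE
    _ = gradBound S c * E ^ 2 := by ring

/-- EXPLICIT HEADLINE: `ε² ≤ Λ₁(S) ‖c‖ E²` on every LH-window, `Λ₁(S) = 2π ∑ᵢ ∑_{k∈S} |kᵢ|`. -/
theorem sq_le_explicit_of_lhWindow (hε : 0 < ε) {U : Set (↥S → (EuclideanSpace ℂ (Fin 3)))}
    (hU : ∀ j : ℕ, U ⊆ closure (lhLoudSet S E ε j)) {c : ↥S → (EuclideanSpace ℂ (Fin 3))} (hc : c ∈ U) :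
    ε ^ 2 ≤ (∑ i : Fin 3, ∑ k : ↥S, 2 * Real.pi * |(((k : Fin 3 → ℤ) i : ℤ) : ℝ)|) * ‖c‖ * E ^ 2 :=
  (sq_le_gradBound_mul_sq_of_lhWindow hε hU hc).trans
    (mul_le_mul_of_nonneg_right (gradBound_le S c) (sq_nonneg _))

end Consequences


end Summit.AnomalousDissipation.AnomalousDissipation.Theorems.DenseLoudLerayHopfForces

end
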